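import Summits.Parity.BatemanHorn.Theorems.SoloInformedThinCounting
import Mathlib.Analysis.SpecialFunctions.Pow.Asymptotics
import HarnessLib

/-!
# Thin sequences vs. Type-II information, VI: general comparison sequences

Part of the `SoloInformedThin*` series.  The files `…TypeII`, `…TypeIIVoid` treat Ford–Maynard's
bound (II) for `w = a − 1`, i.e. against the comparison sequence `b = 1` fixed by the tree's
`Literature.Barriers.Parity.FordMaynard.TypeII`.  Ford–Maynard allow a general non-negative
comparison sequence `(b_n)` "with similar distributional properties to `(a_n)`" subject to their
hypotheses (b.1)–(b.2) — e.g. `b_n = (xq/2)/(yφ(q)) · 1_{x−y<n≤x, (n,q)=1}` (Lemma 4.6) — and for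
a polynomial sequence the natural comparison carries the local densities.  This file removes the
restriction `b = 1` from the Type-II half: the argument only uses that `b ≥ 0`, `b ≤ x^η`, and
that `b` puts mass `≥ x/(4p)` on the multiples of each prime `p` of the Type-II window.

* `typeII_zero_pairs_sum_le` — for `b ≥ 0`: if `f m ∧ g n ⇒ a(mn) = 0` then (II) for `w = a − b`
  (tested with `ξ = 1_f`, `κ = 1_g`) gives `∑_{f m ∧ g n} b(mn) ≤ x/(log x)^B`;
* `typeII_sparse_le_cmp` — primes `p > M` of `S` in the window, `A ⊇ supp a ∩ (x/2, x]`,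
  `0 ≤ b ≤ β`: `∑_{p ∈ S} ∑_{x/2 < pn ≤ x} b(pn) − #S · β · #A · log x/log M ≤ x/(log x)^B`;
* `eventually_not_typeII_of_sparse_cmp` — `0 ≤ θ`, `0 ≤ η`, `θ + η < c ≤ 1`, `ν > 0`, `B > 1`:
  for all large `x`, no real `a` with at most `x^{1−c}` non-zero values on `(x/2, x]` and no
  comparison `b` with `0 ≤ b ≤ x^η` and `∑_{x/2<pn≤x} b(pn) ≥ x/(4p)` for the primes `p` of the
  window have `w = a − b` satisfying (II) in `[θ, θ + ν]`.
For `b = 1` (`η = 0`) this is `eventually_not_typeII_of_sparse`; for a set with `x^{1/2}` elements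
(`c = 1/2`) and FM's short-interval comparison sequences (`η` of order `ν/11`) it excludes every
window with `θ < 1/2 − η`.

References: [cite: FordMaynard2024PrimeSieves, §2.4 (p. 7, first family)]
[cite: FordMaynard2024PrimeSieves, §4.2 (hypotheses (b.1), (b.2), Lemma 4.6)]
[cite: FordMaynard2024PrimeSieves, §1 (II)].
-/

noncomputable section

open Filter Finset Real

namespace Summit.Parity.BatemanHorn.Theorems

open Literature.Barriers.Parity.FordMaynard (TypeII eventually_mul_rpow_le_rpow)

/-- **Zero pairs are weighed by (II), general comparison.**  If `b ≥ 0` and `f m ∧ g n` forces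
`a(mn) = 0` on `x/2 < mn ≤ x`, then testing (II) for `w = a − b` with `ξ = 1_f`, `κ = 1_g` gives
`∑_{m} ∑_{n : f m ∧ g n} b(mn) ≤ x/(log x)^B` over the Type-II summation range.
[cite: FordMaynard2024PrimeSieves, §1 (II)] -/
theorem typeII_zero_pairs_sum_le {a b : ℕ → ℝ} {x θ ν B : ℝ} (hB : 0 ≤ B) (f g : ℕ → Prop)
    [DecidablePred f] [DecidablePred g] (hb : ∀ n, 0 ≤ b n)
    (hfg : ∀ m n : ℕ, f m → g n → x / 2 < (m * n : ℝ) → (m * n : ℝ) ≤ x → a (m * n) = 0)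
    (h : TypeII (fun n : ℕ => a n - b n) x θ ν B) :
    ∑ m ∈ (Icc 1 ⌊x ^ (θ + ν)⌋₊).filter (fun m : ℕ => (x / 2) ^ θ < (m : ℝ)),
        ∑ n ∈ ((Icc 1 ⌊x⌋₊).filter
            (fun n : ℕ => x / 2 < (m * n : ℝ) ∧ (m * n : ℝ) ≤ x)).filter
          (fun n : ℕ => f m ∧ g n), b (m * n)
      ≤ x / Real.log x ^ B := by
  set W : Finset ℕ :=
    (Icc 1 ⌊x ^ (θ + ν)⌋₊).filter (fun m : ℕ => (x / 2) ^ θ < (m : ℝ)) with hW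
  set Nw : ℕ → Finset ℕ := fun m : ℕ =>
    (Icc 1 ⌊x⌋₊).filter (fun n : ℕ => x / 2 < (m * n : ℝ) ∧ (m * n : ℝ) ≤ x) with hNw
  set ξ : ℕ → ℂ := fun m : ℕ => if m ≠ 0 ∧ f m then 1 else 0 with hξ
  set κ : ℕ → ℂ := fun n : ℕ => if n ≠ 0 ∧ g n then 1 else 0 with hκ
  have key : ‖∑ m ∈ W, ∑ n ∈ Nw m, ξ m * κ n * ((a (m * n) - b (m * n) : ℝ) : ℂ)‖ ≤
      x / Real.log x ^ B :=
    h ξ κ (fun m : ℕ => norm_indicator_le_divisors_rpow hB f m)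
      (fun n : ℕ => norm_indicator_le_divisors_rpow hB g n)
  have hterm : ∀ m ∈ W, ∀ n ∈ Nw m,
      ξ m * κ n * ((a (m * n) - b (m * n) : ℝ) : ℂ) =
        if f m ∧ g n then -((b (m * n) : ℝ) : ℂ) else 0 := by
    intro m hm n hn
    have hm' : m ∈ W := hm
    simp only [hW, mem_filter, mem_Icc] at hm'
    have hm0 : m ≠ 0 := by omega
    have hn' : n ∈ Nw m := hn
    simp only [hNw, mem_filter, mem_Icc] at hn'
    have hn0 : n ≠ 0 := by omega
    by_cases hc : f m ∧ g n
    · have h0 := hfg m n hc.1 hc.2 hn'.2.1 hn'.2.2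
      simp [hξ, hκ, hm0, hn0, hc, h0]
    · rw [if_neg hc]
      rcases not_and_or.mp hc with h1 | h1
      · simp [hξ, h1]
      · simp [hκ, h1]
  have hsum : ∑ m ∈ W, ∑ n ∈ Nw m, ξ m * κ n * ((a (m * n) - b (m * n) : ℝ) : ℂ) =
      -(((∑ m ∈ W, ∑ n ∈ (Nw m).filter (fun n : ℕ => f m ∧ g n), b (m * n) : ℝ) : ℂ)) := by
    rw [Complex.ofReal_sum, ← Finset.sum_neg_distrib]
    refine Finset.sum_congr rfl fun m hm => ?_
    conv_rhs => rw [Finset.sum_filter, Complex.ofReal_sum, ← Finset.sum_neg_distrib]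
    refine Finset.sum_congr rfl fun n hn => ?_
    rw [hterm m hm n hn]
    split_ifs <;> simp
  have hnn : 0 ≤ ∑ m ∈ W, ∑ n ∈ (Nw m).filter (fun n : ℕ => f m ∧ g n), b (m * n) :=
    sum_nonneg fun m _ => sum_nonneg fun n _ => hb _
  rw [hsum, norm_neg, Complex.norm_real, Real.norm_eq_abs, abs_of_nonneg hnn] at key
  exact key

/-- **(II) against a thin support, general comparison, primes on the `m`-side.**  Let `S` be a
finite set of primes `p > M` inside the Type-II window `((x/2)^θ, x^{θ+ν}]`, let `A` contain the
support of `a` on `(x/2, x]`, and let `0 ≤ b ≤ β`.  If `w = a − b` satisfies (II), then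
`∑_{p ∈ S} ∑_{x/2 < pn ≤ x} b(pn) − #S · (β · #A · log x / log M) ≤ x/(log x)^B`.
[cite: FordMaynard2024PrimeSieves, §2.4] -/
theorem typeII_sparse_le_cmp {a b : ℕ → ℝ} {x θ ν B β : ℝ} (hB : 0 ≤ B) (hx : 1 ≤ x) {M : ℝ}
    (hM : 1 < M) (S A : Finset ℕ)
    (hS : ∀ p ∈ S, p.Prime ∧ M < (p : ℝ) ∧ (x / 2) ^ θ < (p : ℝ) ∧ (p : ℝ) ≤ x ^ (θ + ν))
    (hA : ∀ v : ℕ, x / 2 < (v : ℝ) → (v : ℝ) ≤ x → a v ≠ 0 → v ∈ A)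
    (hb0 : ∀ n, 0 ≤ b n) (hbβ : ∀ n, b n ≤ β)
    (h : TypeII (fun n : ℕ => a n - b n) x θ ν B) :
    ∑ p ∈ S, ∑ n ∈ (Icc 1 ⌊x⌋₊).filter
        (fun n : ℕ => x / 2 < (p * n : ℝ) ∧ (p * n : ℝ) ≤ x), b (p * n)
      - S.card * (β * (A.card * (Real.log x / Real.log M)))
      ≤ x / Real.log x ^ B := by
  have hβ : 0 ≤ β := (hb0 0).trans (hbβ 0)
  set L := Real.log x / Real.log M with hL
  set W : Finset ℕ :=
    (Icc 1 ⌊x ^ (θ + ν)⌋₊).filter (fun m : ℕ => (x / 2) ^ θ < (m : ℝ)) with hW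
  set Nw : ℕ → Finset ℕ := fun m : ℕ =>
    (Icc 1 ⌊x⌋₊).filter (fun n : ℕ => x / 2 < (m * n : ℝ) ∧ (m * n : ℝ) ≤ x) with hNw
  -- (II) tested against `ξ = 1_S`, `κ = 1_{good cofactors}`
  have hT : ∑ m ∈ W, ∑ n ∈ (Nw m).filter (fun n : ℕ => m ∈ S ∧
      ∀ q ∈ S, x / 2 < (q * n : ℝ) → (q * n : ℝ) ≤ x → a (q * n) = 0), b (m * n) ≤
      x / Real.log x ^ B :=
    typeII_zero_pairs_sum_le hB (fun m : ℕ => m ∈ S)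
      (fun n : ℕ => ∀ q ∈ S, x / 2 < (q * n : ℝ) → (q * n : ℝ) ≤ x → a (q * n) = 0) hb0
      (fun m n hm hn h1 h2 => hn m hm h1 h2) h
  have hS' : ∀ p ∈ S, p.Prime ∧ M < (p : ℝ) := fun p hp => ⟨(hS p hp).1, (hS p hp).2.1⟩
  have hSW : S ⊆ W := by
    intro p hp
    obtain ⟨hpr, _, h1, h2⟩ := hS p hp
    rw [hW, Finset.mem_filter, mem_Icc]
    exact ⟨⟨hpr.one_le, Nat.le_floor h2⟩, h1⟩
  -- the bad cofactors
  set E : Finset ℕ := (Icc 1 ⌊x⌋₊).filter (fun r : ℕ => ∃ p : ℕ, p ∈ S ∧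
      (x / 2 < (p * r : ℝ) ∧ (p * r : ℝ) ≤ x) ∧ a (p * r) ≠ 0) with hE
  have hEcard : (E.card : ℝ) ≤ A.card * L :=
    card_badCofactors_le hx hM S A E hS' hA (fun r hr => by
      have hr' := hr
      simp only [hE, Finset.mem_filter] at hr'
      exact hr'.2)
  have hstep : ∀ p ∈ S, ∑ n ∈ Nw p, b (p * n) - β * (A.card * L) ≤
      ∑ n ∈ (Nw p).filter (fun n : ℕ => p ∈ S ∧
        ∀ q ∈ S, x / 2 < (q * n : ℝ) → (q * n : ℝ) ≤ x → a (q * n) = 0), b (p * n) := by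
    intro p hp
    -- complement of the good cofactors inside `Nw p` lies in `E`
    have hsub2 : (Nw p).filter (fun n : ℕ => ¬ (p ∈ S ∧
        ∀ q ∈ S, x / 2 < (q * n : ℝ) → (q * n : ℝ) ≤ x → a (q * n) = 0)) ⊆ E := by
      intro n hn
      rw [Finset.mem_filter] at hn
      obtain ⟨hnN, hneg⟩ := hn
      have hnI : n ∈ Icc 1 ⌊x⌋₊ := by
        have := hnN
        simp only [hNw, Finset.mem_filter] at this
        exact this.1
      simp only [hE, Finset.mem_filter]
      refine ⟨hnI, ?_⟩
      by_contra hno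
      apply hneg
      refine ⟨hp, fun q hq h1 h2 => ?_⟩
      by_contra hne
      exact hno ⟨q, hq, ⟨h1, h2⟩, hne⟩
    have hsplit := (sum_filter_add_sum_filter_not (Nw p) (fun n : ℕ => p ∈ S ∧
        ∀ q ∈ S, x / 2 < (q * n : ℝ) → (q * n : ℝ) ≤ x → a (q * n) = 0)
        (fun n : ℕ => b (p * n)))
    have hbad : ∑ n ∈ (Nw p).filter (fun n : ℕ => ¬ (p ∈ S ∧
        ∀ q ∈ S, x / 2 < (q * n : ℝ) → (q * n : ℝ) ≤ x → a (q * n) = 0)), b (p * n)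
        ≤ β * (A.card * L) := by
      calc ∑ n ∈ (Nw p).filter (fun n : ℕ => ¬ (p ∈ S ∧
            ∀ q ∈ S, x / 2 < (q * n : ℝ) → (q * n : ℝ) ≤ x → a (q * n) = 0)), b (p * n)
          ≤ ∑ n ∈ E, b (p * n) := sum_le_sum_of_subset_of_nonneg hsub2 (fun _ _ _ => hb0 _)
        _ ≤ ∑ _n ∈ E, β := sum_le_sum fun n _ => hbβ _
        _ = E.card * β := by rw [sum_const, nsmul_eq_mul]
        _ ≤ A.card * L * β := mul_le_mul_of_nonneg_right hEcard hβ
        _ = β * (A.card * L) := by ring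
    linarith
  have hsum := sum_le_sum hstep
  have hsub : ∑ p ∈ S, ∑ n ∈ (Nw p).filter (fun n : ℕ => p ∈ S ∧
        ∀ q ∈ S, x / 2 < (q * n : ℝ) → (q * n : ℝ) ≤ x → a (q * n) = 0), b (p * n) ≤
      ∑ m ∈ W, ∑ n ∈ (Nw m).filter (fun n : ℕ => m ∈ S ∧
        ∀ q ∈ S, x / 2 < (q * n : ℝ) → (q * n : ℝ) ≤ x → a (q * n) = 0), b (m * n) :=
    sum_le_sum_of_subset_of_nonneg hSW (fun _ _ _ => sum_nonneg fun _ _ => hb0 _)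
  have hsplit : ∑ p ∈ S, (∑ n ∈ Nw p, b (p * n) - β * (A.card * L)) =
      ∑ p ∈ S, ∑ n ∈ Nw p, b (p * n) - S.card * (β * (A.card * L)) := by
    rw [sum_sub_distrib, sum_const, nsmul_eq_mul]
  have hchain := hsum.trans (hsub.trans hT)
  rw [hsplit] at hchain
  exact hchain

/-- **No Type-II information below the density exponent, general comparison.**  Let `0 ≤ θ`,
`0 ≤ η`, `θ + η < c ≤ 1`, `ν > 0`, `B > 1`.  For all large `x`: for no real sequence `a` with at
most `x^{1−c}` non-zero values on `(x/2, x]` and no comparison sequence `b` with `0 ≤ b ≤ x^η`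
which puts mass `∑_{x/2 < pn ≤ x} b(pn) ≥ x/(4p)` on the multiples of every prime `p` of the window
`((x/2)^θ, x^{θ+ν}]` does `w = a − b` satisfy (II) in the range `[θ, θ + ν]`.
[cite: FordMaynard2024PrimeSieves, §2.4] [cite: FordMaynard2024PrimeSieves, §4.2 (Lemma 4.6)] -/
theorem eventually_not_typeII_of_sparse_cmp {c θ ν B η : ℝ} (hθ : 0 ≤ θ) (hη : 0 ≤ η)
    (hθc : θ + η < c) (hc1 : c ≤ 1) (hν : 0 < ν) (hB : 1 < B) :
    ∀ᶠ x : ℝ in atTop, ∀ (a b : ℕ → ℝ) (A : Finset ℕ), (A.card : ℝ) ≤ x ^ (1 - c) →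
      (∀ v : ℕ, x / 2 < (v : ℝ) → (v : ℝ) ≤ x → a v ≠ 0 → v ∈ A) →
      (∀ n, 0 ≤ b n) → (∀ n, b n ≤ x ^ η) →
      (∀ p : ℕ, p.Prime → (x / 2) ^ θ < (p : ℝ) → (p : ℝ) ≤ x ^ (θ + ν) →
        x / (4 * p) ≤ ∑ n ∈ (Icc 1 ⌊x⌋₊).filter
          (fun n : ℕ => x / 2 < (p * n : ℝ) ∧ (p * n : ℝ) ≤ x), b (p * n)) →
      ¬ TypeII (fun n : ℕ => a n - b n) x θ ν B := by
  obtain ⟨K, hK1, hK⟩ := exists_card_primes_Ioc_two_mul_ge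
  have hK0 : 0 < K := by linarith
  have hδ : 0 < (c - θ - η) / 2 := by linarith
  filter_upwards [eventually_ge_atTop (4 : ℝ),
    eventually_mul_rpow_le_rpow 6 (by linarith : θ < θ + ν),
    eventually_mul_rpow_le_rpow 48 (by linarith : θ < 1),
    eventually_mul_rpow_le_rpow 192 (by linarith : θ + η + (1 - c) + (c - θ - η) / 2 < 1),
    (isLittleO_log_rpow_atTop hδ).bound one_pos,
    ((tendsto_rpow_atTop (by linarith : 0 < B - 1)).comp
      Real.tendsto_log_atTop).eventually_gt_atTop (8 * (2 * K))]
    with x hx4 e1 e2 e3 elog e4 a b A hA hcov hb0 hbη hbm hII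
  rw [Real.rpow_one] at e2 e3
  have hx0 : 0 < x := by linarith
  have hx1 : 1 ≤ x := by linarith
  have hlx : 0 ≤ Real.log x := Real.log_nonneg hx1
  have hlogle : Real.log x ≤ x ^ ((c - θ - η) / 2) := by
    have := elog
    simp only [one_mul, Real.norm_eq_abs] at this
    rwa [abs_of_nonneg hlx, abs_of_nonneg (Real.rpow_nonneg hx0.le _)] at this
  have e4' : 8 * (2 * K) < Real.log x ^ (B - 1) := by simpa using e4
  -- the scale `M` and the primes `S`
  set M : ℕ := ⌊(x / 2) ^ θ⌋₊ + 2 with hMdef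
  have hM2 : 2 ≤ M := by omega
  have hM2r : (2 : ℝ) ≤ M := by exact_mod_cast hM2
  have hMθ : (x / 2) ^ θ < M := by
    have := Nat.lt_floor_add_one ((x / 2) ^ θ)
    push_cast [hMdef]
    linarith
  have hxθ1 : 1 ≤ x ^ θ := Real.one_le_rpow hx1 hθ
  have hMle : (M : ℝ) ≤ 3 * x ^ θ := by
    have h1 : (⌊(x / 2) ^ θ⌋₊ : ℝ) ≤ (x / 2) ^ θ :=
      Nat.floor_le (Real.rpow_nonneg (by linarith) _)
    have h2 : (x / 2) ^ θ ≤ x ^ θ := Real.rpow_le_rpow (by linarith) (by linarith) hθ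
    push_cast [hMdef]
    linarith
  set S : Finset ℕ := (Ioc M (2 * M)).filter Nat.Prime with hSdef
  have hSprop : ∀ p ∈ S, p.Prime ∧ (M : ℝ) < p ∧ (x / 2) ^ θ < (p : ℝ) ∧
      (p : ℝ) ≤ x ^ (θ + ν) := by
    intro p hp
    rw [hSdef, mem_filter, mem_Ioc] at hp
    obtain ⟨⟨hMp, hp2M⟩, hpr⟩ := hp
    have hMp' : (M : ℝ) < p := by exact_mod_cast hMp
    have hp2M' : (p : ℝ) ≤ 2 * M := by exact_mod_cast hp2M
    exact ⟨hpr, hMp', hMθ.trans hMp', by linarith⟩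
  have hmain := typeII_sparse_le_cmp (by linarith) hx1 (by linarith : (1 : ℝ) < M) S A hSprop
    hcov hb0 hbη hII
  -- lower bounds
  have hL : Real.log x / Real.log M ≤ 2 * Real.log x := by
    have hlogM : Real.log 2 ≤ Real.log M := Real.log_le_log two_pos hM2r
    have hl2 := Real.log_two_gt_d9
    rw [div_le_iff₀ (by linarith)]
    nlinarith
  have hcardS := hK M (by omega)
  have hsum : (S.card : ℝ) * (x / (8 * M)) ≤ ∑ p ∈ S, ∑ n ∈ (Icc 1 ⌊x⌋₊).filter
      (fun n : ℕ => x / 2 < (p * n : ℝ) ∧ (p * n : ℝ) ≤ x), b (p * n) := by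
    rw [← nsmul_eq_mul, ← sum_const]
    refine sum_le_sum fun p hp => ?_
    have hp2M : (p : ℝ) ≤ 2 * M := by
      have := hp; rw [hSdef, mem_filter, mem_Ioc] at this; exact_mod_cast this.1.2
    obtain ⟨hpr, _, hpθ, hpθν⟩ := hSprop p hp
    have hp0 : (0 : ℝ) < p := by exact_mod_cast hpr.pos
    have : x / (8 * M) ≤ x / (4 * p) :=
      div_le_div_of_nonneg_left hx0.le (by positivity) (by linarith)
    exact this.trans (hbm p hpr hpθ hpθν)
  have hX : (S.card : ℝ) * (x ^ η * (A.card * (Real.log x / Real.log M))) ≤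
      S.card * (x ^ η * (x ^ (1 - c) * (2 * Real.log x))) := by
    apply mul_le_mul_of_nonneg_left _ (Nat.cast_nonneg _)
    apply mul_le_mul_of_nonneg_left _ (Real.rpow_nonneg hx0.le _)
    exact mul_le_mul hA hL (div_nonneg hlx (Real.log_nonneg (by linarith)))
      (Real.rpow_nonneg hx0.le _)
  have h16M : 16 * (M : ℝ) * (2 * x ^ η * x ^ (1 - c) * Real.log x) ≤ x / 2 := by
    have hnn1 : 0 ≤ x ^ (1 - c) := Real.rpow_nonneg hx0.le _
    have hnn2 : 0 ≤ x ^ η := Real.rpow_nonneg hx0.le _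
    have hprod : x ^ θ * x ^ η * x ^ (1 - c) * x ^ ((c - θ - η) / 2) =
        x ^ (θ + η + (1 - c) + (c - θ - η) / 2) := by
      rw [← Real.rpow_add hx0, ← Real.rpow_add hx0, ← Real.rpow_add hx0]
    have t2a : (M : ℝ) * (x ^ η * x ^ (1 - c) * Real.log x) ≤
        3 * x ^ θ * (x ^ η * x ^ (1 - c) * x ^ ((c - θ - η) / 2)) :=
      mul_le_mul hMle (mul_le_mul_of_nonneg_left hlogle (by positivity)) (by positivity)
        (by positivity)
    rw [← hprod] at e3
    have : 3 * x ^ θ * (x ^ η * x ^ (1 - c) * x ^ ((c - θ - η) / 2)) =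
        3 * (x ^ θ * x ^ η * x ^ (1 - c) * x ^ ((c - θ - η) / 2)) := by ring
    rw [this] at t2a
    have : 16 * (M : ℝ) * (2 * x ^ η * x ^ (1 - c) * Real.log x) =
        32 * ((M : ℝ) * (x ^ η * x ^ (1 - c) * Real.log x)) := by ring
    rw [this]
    linarith
  have h8M : 8 * (M : ℝ) ≤ x / 2 := by linarith
  have h2Mx : 2 * (M : ℝ) ≤ x := by linarith
  have hlog2M0 : 0 < Real.log (2 * M) := Real.log_pos (by linarith)
  have hlog2M : Real.log (2 * M) ≤ Real.log x := Real.log_le_log (by positivity) h2Mx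
  have hlx0 : 0 < Real.log x := by linarith
  have hTlow : x / (8 * (2 * K) * Real.log x) ≤ (S.card : ℝ) * (x / (16 * M)) := by
    have hMK : (M : ℝ) / (K * Real.log x) ≤ S.card :=
      le_trans (div_le_div_of_nonneg_left (by positivity) (mul_pos hK0 hlog2M0)
        (mul_le_mul_of_nonneg_left hlog2M hK0.le)) hcardS
    have hMne : (M : ℝ) ≠ 0 := by positivity
    have hlxne : Real.log x ≠ 0 := hlx0.ne'
    have hKne : K ≠ 0 := hK0.ne'
    calc x / (8 * (2 * K) * Real.log x) = (M : ℝ) / (K * Real.log x) * (x / (16 * M)) := by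
          field_simp
          ring
      _ ≤ S.card * (x / (16 * M)) := mul_le_mul_of_nonneg_right hMK (by positivity)
  have hmid : (S.card : ℝ) * (x / (16 * M)) ≤
      S.card * (x / (8 * M) - x ^ η * (x ^ (1 - c) * (2 * Real.log x))) := by
    apply mul_le_mul_of_nonneg_left _ (Nat.cast_nonneg _)
    have hM16 : (0 : ℝ) < 16 * M := by positivity
    have h81 : 2 * x ^ η * x ^ (1 - c) * Real.log x ≤ x / (2 * (16 * M)) := by
      rw [le_div_iff₀ (by positivity)]; linarith
    have hMne : (M : ℝ) ≠ 0 := by positivity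
    have h84 : x / (8 * M) = 2 * (x / (16 * M)) := by
      field_simp; ring
    have h85 : x / (2 * (16 * M)) = (x / (16 * M)) / 2 := by
      field_simp
    have : x ^ η * (x ^ (1 - c) * (2 * Real.log x)) = 2 * x ^ η * x ^ (1 - c) * Real.log x := by
      ring
    rw [this, h84]
    rw [h85] at h81
    have hu : 0 ≤ x / (16 * M) := by positivity
    linarith
  have hfin := div_log_rpow_lt (by positivity : 0 < 2 * K) (by linarith) e4'
  linarith
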